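import Mathlib.CategoryTheory.Conj
import Mathlib.Algebra.Group.Commute.Units
import Literature.AlgebraicGeometry.Frobenioids.BirationalizationBaseIdentity
import Literature.AlgebraicGeometry.Frobenioids.BiratLocalizationUniversal
import Literature.AlgebraicGeometry.Frobenioids.ModelFrobenioidComparison
import Literature.AlgebraicGeometry.Frobenioids.BiratUnits
import Literature.AlgebraicGeometry.Frobenioids.CoAngular
import HarnessLib

/-!
# Frobenioids I, Def. 4.5 (i): a CRITERION for "`A` is birationally Frobenius-normalized" from data of `C`
# alone (no computation with fractions) — PROOFS

Mochizuki, *The geometry of Frobenioids I: the general theory*, Kyushu J. Math. **62** (2008) 293–400,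
Def. 4.5 (i) p. 86 ("we shall say that `A` is *birationally Frobenius-normalized* if the image of `A` in
`C^birat` is Frobenius-normalized"), Def. 1.2 (iv) p. 23 (Frobenius-normalized: "`α^{deg_Fr(φ)} ∘ φ = φ ∘ α`
for base-identity endomorphisms `φ` and `α ∈ O^▷(A)`"), Prop. 4.4 (i)/(iv) pp. 82–83 (morphisms of
`C^birat` are classes of pairs `(α : A′ → A, φ′ : A′ → B)` with `α` a co-angular pre-step).
[cite: MochizukiFrdI2008, Def. 4.5 (i) p.86]

PROOF-ONLY (theorems, no `def`; cell abc-iut, seat abc-iut-L1-t9 — written for [FrdII] Thm. 3.6 (i)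
"`C^Λ` is of rationally standard type", whose clause (a) "birationally Frobenius-normalized" the author
calls "immediate from the construction of `C^Λ`" (FrdII p. 38 l. 15); the present file is the generic
half of that verification).

`PreFrobenioid.Birat.isBiratFrobeniusNormalized_of_restrictions` — for a Frobenioid `C → F_Φ` (with THE
birationalization `Birat F hF hsq` of abc-iut-L6-t8) and an object `A`, suppose that
(N) every domain `T` of a co-angular pre-step `T → A` is Frobenius-normalized in `C`, and
(H) for every co-angular pre-step `δ : T → A` and every `ν : T → A` with `Base(ν) = Base(δ)` there are
    `ρ ∈ O^▷(T)` and a base-identity endomorphism `ε` of `T` with `ρ ≫ ν = ε ≫ δ` ("after shrinking by a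
    unit-like endomorphism, every arrow base-equivalent to `δ` is `δ` preceded by an endomorphism");
then `A` is birationally Frobenius-normalized.  Proof: a base-identity endomorphism `φ` of `A^birat` and an
`α ∈ O^▷(A^birat)` are classes `[(δ₁, ν₁)]`, `[(δ₂, ν₂)]` of base-equivalent pairs (abc-iut-w5-d190's
`isBaseIdentity_iff_exists_baseEquivalent`, `mem_endSubmonoid_iff_exists`); refine to a COMMON co-angular
pre-step `δ : T → A` (`exists_common_refinement`); by (H), `φ = d⁻¹ r₁⁻¹ e₁ d` and `α = d⁻¹ r₂⁻¹ e₂ d` with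
`d = δ^birat`, `rᵢ = ρᵢ^birat` isomorphisms and `eᵢ = εᵢ^birat`; the identity `φ ∘ α^n = α ∘ φ` is then the
image under the monoid homomorphism `End_C(T) → End(T^birat) ⥲ End(A^birat)` of the Frobenius
normalization of `T` in `C` (N) and of the commutativity of `O^▷(T)` (Rem. 1.3.1).

Nothing is defined; no statement of the paper is strengthened; nothing here bears on [IUTchIII] Cor. 3.12
(L1 = [FrdI], a refereed preparatory paper).
-/

namespace Literature.AlgebraicGeometry.Frobenioids

open CategoryTheory Opposite

universe w v v' u u'

namespace PreFrobenioid

namespace Birat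

variable {D : Type u} [Category.{v} D] {Φ : Dᵒᵖ ⥤ CommMonCat.{w}}
  {C : Type u'} [Category.{v'} C] {F : C ⥤ ElemFrobenioid Φ}
  {hF : IsFrobenioid F} {hsq : HasBiratSquares F}

/-- Monoid algebra behind Frobenius normalization of fractions: if `u, v, Q` pairwise commute,
`Q^n P = P Q` and `v^n P = P v`, then `(Q v⁻¹)^n (P u⁻¹) = (P u⁻¹)(Q v⁻¹)`. [folklore] -/
private theorem pow_frac_mul_frac {M : Type*} [Monoid M] (P Q : M) (u v : Mˣ) (n : ℕ)
    (hUV : Commute (u : M) v) (hUQ : Commute (u : M) Q) (hVQ : Commute (v : M) Q)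
    (hQP : Q ^ n * P = P * Q) (hVP : (v : M) ^ n * P = P * v) :
    (Q * ↑v⁻¹) ^ n * (P * ↑u⁻¹) = P * ↑u⁻¹ * (Q * ↑v⁻¹) := by
  have hVQ' : Commute Q (↑v⁻¹ : M) := hVQ.symm.units_inv_right
  have key : (↑v⁻¹ : M) ^ n * P = P * ↑v⁻¹ := by
    have h1 : P = ↑(v ^ n)⁻¹ * (P * ↑v) := by
      rw [Units.eq_inv_mul_iff_mul_eq, Units.val_pow_eq_pow_val, hVP]
    rw [← Units.val_pow_eq_pow_val, inv_pow]
    conv_rhs => rw [h1]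
    rw [mul_assoc, Units.mul_inv_cancel_right]
  have hUQ' : (↑u⁻¹ : M) * Q = Q * ↑u⁻¹ := hUQ.units_inv_left
  have hUV' : (↑u⁻¹ : M) * ↑v⁻¹ = ↑v⁻¹ * ↑u⁻¹ := (hUV.units_inv_left.units_inv_right).eq
  calc (Q * ↑v⁻¹) ^ n * (P * ↑u⁻¹)
      = Q ^ n * ((↑v⁻¹ : M) ^ n * P) * ↑u⁻¹ := by rw [hVQ'.mul_pow]; simp only [mul_assoc]
    _ = (Q ^ n * P) * ↑v⁻¹ * ↑u⁻¹ := by rw [key]; simp only [mul_assoc]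
    _ = P * Q * (↑v⁻¹ * ↑u⁻¹) := by rw [hQP]; simp only [mul_assoc]
    _ = P * (↑u⁻¹ * Q) * ↑v⁻¹ := by rw [← hUV', hUQ']; simp only [mul_assoc]
    _ = P * ↑u⁻¹ * (Q * ↑v⁻¹) := by simp only [mul_assoc]

/-- **Criterion for Def. 4.5 (i).** Let `C → F_Φ` be a Frobenioid and `A ∈ Ob(C)`. If every domain of a
co-angular pre-step into `A` is Frobenius-normalized (Def. 1.2 (iv)), and every arrow `ν : T → A`
base-equivalent to a co-angular pre-step `δ : T → A` satisfies `ρ ≫ ν = ε ≫ δ` for some `ρ ∈ O^▷(T)` and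
some base-identity endomorphism `ε` of `T`, then `A` is birationally Frobenius-normalized, i.e. `A^birat`
is Frobenius-normalized in THE birationalization `C^birat → F_{Φ^gp}`.
[cite: MochizukiFrdI2008, Def. 4.5 (i) p.86] -/
theorem isBiratFrobeniusNormalized_of_restrictions (A : C)
    (hN : ∀ ⦃T : C⦄ (δ : T ⟶ A), IsCoAngularPreStep F δ → IsFrobeniusNormalized F T)
    (hH : ∀ ⦃T : C⦄ (δ : T ⟶ A), IsCoAngularPreStep F δ → ∀ ν : T ⟶ A, Base F ν = Base F δ →
      ∃ ρ ε : T ⟶ T, (show End T from ρ) ∈ endSubmonoid F T ∧ IsBaseIdentity F ε ∧ ρ ≫ ν = ε ≫ δ) :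
    IsBiratFrobeniusNormalized F hF hsq A := by
  change IsFrobeniusNormalized (toElemZero hF hsq) ((toBirat F hF hsq).obj A)
  intro φ hφ α hα
  -- (1) present `φ`, `α` by base-equivalent pairs
  obtain ⟨f₁, hf₁, hb₁⟩ := (isBaseIdentity_iff_exists_baseEquivalent (hF := hF) (hsq := hsq) φ).mp hφ
  obtain ⟨f₂, hf₂, hb₂, hl₂⟩ := (mem_endSubmonoid_iff_exists (hF := hF) (hsq := hsq) α).mp hα
  have hn : (degFr (toElemZero hF hsq) φ : ℕ) = (degFr F f₁.num : ℕ) := by rw [← hf₁]; rfl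
  -- (2) common refinement `δ = κ₁ ≫ f₁.den = κ₂ ≫ f₂.den`
  obtain ⟨T, κ₁, κ₂, hκ₁, hκ₂, hκ⟩ :=
    exists_common_refinement hF f₁.den f₂.den f₁.den_mem f₂.den_mem
  have hδ : IsCoAngularPreStep F (κ₁ ≫ f₁.den) := hκ₁.comp hF f₁.den_mem
  let g₁ : BiratFrac F A A := ⟨T, κ₁ ≫ f₁.den, κ₁ ≫ f₁.num, hδ⟩
  let g₂ : BiratFrac F A A := ⟨T, κ₂ ≫ f₂.den, κ₂ ≫ f₂.num, hκ₂.comp hF f₂.den_mem⟩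
  have hg₁ : φ = homMk g₁ :=
    hf₁.symm.trans (homMk_sound (BiratFrac.rel_restrict hF f₁ κ₁ hκ₁)).symm
  have hg₂ : (show _ ⟶ _ from α) = homMk g₂ :=
    hf₂.symm.trans (homMk_sound (BiratFrac.rel_restrict hF f₂ κ₂ hκ₂)).symm
  -- (3) the hypothesis (H) at `δ`
  have hbν₁ : Base F (κ₁ ≫ f₁.num) = Base F (κ₁ ≫ f₁.den) := by
    rw [base_comp, base_comp, hb₁]
  have hbν₂ : Base F (κ₂ ≫ f₂.num) = Base F (κ₁ ≫ f₁.den) := by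
    rw [base_comp, hκ, base_comp, hb₂]
  obtain ⟨ρ₁, ε₁, hρ₁, hε₁, h₁⟩ := hH _ hδ _ hbν₁
  obtain ⟨ρ₂, ε₂, hρ₂, hε₂, h₂⟩ := hH _ hδ _ hbν₂
  -- (4) degrees: `deg ε₁ = deg f₁.num`, `deg ε₂ = 1`
  have hdδ : degFr F (κ₁ ≫ f₁.den) = 1 := hδ.2.1
  have hdε₁ : degFr F ε₁ = degFr F f₁.num := by
    have h := congrArg (degFr F) h₁
    rw [degFr_comp, degFr_comp, degFr_comp, hρ₁.2, hκ₁.2.1, hdδ, one_mul, one_mul, mul_one] at h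
    exact h.symm
  have hdε₂ : degFr F ε₂ = 1 := by
    have h := congrArg (degFr F) h₂
    rw [degFr_comp, degFr_comp, degFr_comp, hρ₂.2, hκ₂.2.1, hl₂, hdδ, one_mul, one_mul, mul_one] at h
    exact h.symm
  have hε₂mem : End.of ε₂ ∈ endSubmonoid F T := ⟨hε₂, hdε₂⟩
  -- (5) relations in `End_C(T)`: Frobenius normalization of `T` and commutativity of `O^▷(T)`
  have hTn : IsFrobeniusNormalized F T := hN _ hδ
  have nQP : ε₁ ≫ (show T ⟶ T from End.of ε₂ ^ (degFr F f₁.num : ℕ)) = ε₂ ≫ ε₁ := by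
    rw [← hdε₁]; exact hTn ε₁ hε₁ _ hε₂mem
  have nVP : ε₁ ≫ (show T ⟶ T from End.of ρ₂ ^ (degFr F f₁.num : ℕ)) = ρ₂ ≫ ε₁ := by
    rw [← hdε₁]; exact hTn ε₁ hε₁ _ hρ₂
  have cUV : Commute (End.of ρ₁) (End.of ρ₂) :=
    congrArg Subtype.val (endSubmonoid_comm F hF ⟨End.of ρ₁, hρ₁⟩ ⟨End.of ρ₂, hρ₂⟩)
  have cUQ : Commute (End.of ρ₁) (End.of ε₂) :=
    congrArg Subtype.val (endSubmonoid_comm F hF ⟨End.of ρ₁, hρ₁⟩ ⟨End.of ε₂, hε₂mem⟩)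
  have cVQ : Commute (End.of ρ₂) (End.of ε₂) :=
    congrArg Subtype.val (endSubmonoid_comm F hF ⟨End.of ρ₂, hρ₂⟩ ⟨End.of ε₂, hε₂mem⟩)
  -- (6) transport to `End(T^birat)` along `C → C^birat`
  let Tb := (toBirat F hF hsq).obj T
  let Mh : End T →* End Tb := (toBirat F hF hsq).mapEnd T
  have hρ₁c : IsCoAngularPreStep F ρ₁ :=
    ⟨isCoAngular_endo F hF ρ₁, hρ₁.2, by
      have h : Base F ρ₁ = 𝟙 _ := hρ₁.1
      change IsIso (Base F ρ₁); rw [h]; infer_instance⟩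
  have hρ₂c : IsCoAngularPreStep F ρ₂ :=
    ⟨isCoAngular_endo F hF ρ₂, hρ₂.2, by
      have h : Base F ρ₂ = 𝟙 _ := hρ₂.1
      change IsIso (Base F ρ₂); rw [h]; infer_instance⟩
  haveI i₁ : IsIso ((toBirat F hF hsq).map ρ₁) := toBirat_inverts hF hsq ρ₁ hρ₁c
  haveI i₂ : IsIso ((toBirat F hF hsq).map ρ₂) := toBirat_inverts hF hsq ρ₂ hρ₂c
  haveI iδ : IsIso ((toBirat F hF hsq).map (κ₁ ≫ f₁.den)) := toBirat_inverts hF hsq _ hδ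
  have hden : (toBirat F hF hsq).map (κ₂ ≫ f₂.den) = (toBirat F hF hsq).map (κ₁ ≫ f₁.den) := by
    rw [hκ]
  haveI iδ' : IsIso ((toBirat F hF hsq).map (κ₂ ≫ f₂.den)) := by rw [hden]; infer_instance
  let u : (End Tb)ˣ :=
    ⟨Mh (End.of ρ₁), inv ((toBirat F hF hsq).map ρ₁), by
      change inv ((toBirat F hF hsq).map ρ₁) ≫ (toBirat F hF hsq).map ρ₁ = 𝟙 _
      exact IsIso.inv_hom_id _, by
      change (toBirat F hF hsq).map ρ₁ ≫ inv ((toBirat F hF hsq).map ρ₁) = 𝟙 _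
      exact IsIso.hom_inv_id _⟩
  let v' : (End Tb)ˣ :=
    ⟨Mh (End.of ρ₂), inv ((toBirat F hF hsq).map ρ₂), by
      change inv ((toBirat F hF hsq).map ρ₂) ≫ (toBirat F hF hsq).map ρ₂ = 𝟙 _
      exact IsIso.inv_hom_id _, by
      change (toBirat F hF hsq).map ρ₂ ≫ inv ((toBirat F hF hsq).map ρ₂) = 𝟙 _
      exact IsIso.hom_inv_id _⟩
  have core := pow_frac_mul_frac (Mh (End.of ε₁)) (Mh (End.of ε₂)) u v' (degFr F f₁.num : ℕ)
    (cUV.map Mh) (cUQ.map Mh) (cVQ.map Mh)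
    (by
      change Mh (End.of ε₂) ^ _ * Mh (End.of ε₁) = Mh (End.of ε₁) * Mh (End.of ε₂)
      rw [← map_pow, ← map_mul, ← map_mul]; exact congrArg Mh nQP)
    (by
      change Mh (End.of ρ₂) ^ _ * Mh (End.of ε₁) = Mh (End.of ε₁) * Mh (End.of ρ₂)
      rw [← map_pow, ← map_mul, ← map_mul]; exact congrArg Mh nVP)
  -- (7) `φ = d⁻¹ ≫ (r₁⁻¹ ≫ e₁) ≫ d`, `α = d⁻¹ ≫ (r₂⁻¹ ≫ e₂) ≫ d` with `d = δ^birat`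
  let dI : Tb ≅ (toBirat F hF hsq).obj A := asIso ((toBirat F hF hsq).map (κ₁ ≫ f₁.den))
  have eφ : φ = dI.conj (Mh (End.of ε₁) * ↑u⁻¹) := by
    rw [hg₁, Iso.conj_apply]
    refine (homMk_eq_inv_comp (hF := hF) (hsq := hsq) g₁).trans ?_
    change inv ((toBirat F hF hsq).map (κ₁ ≫ f₁.den)) ≫ (toBirat F hF hsq).map (κ₁ ≫ f₁.num) =
      inv ((toBirat F hF hsq).map (κ₁ ≫ f₁.den)) ≫
        (inv ((toBirat F hF hsq).map ρ₁) ≫ (toBirat F hF hsq).map ε₁) ≫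
          (toBirat F hF hsq).map (κ₁ ≫ f₁.den)
    congr 1
    rw [Category.assoc, IsIso.eq_inv_comp, ← Functor.map_comp, ← Functor.map_comp, h₁]
  have eα : (show _ ⟶ _ from α) = dI.conj (Mh (End.of ε₂) * ↑v'⁻¹) := by
    rw [hg₂, Iso.conj_apply]
    refine (homMk_eq_inv_comp (hF := hF) (hsq := hsq) g₂).trans ?_
    change inv ((toBirat F hF hsq).map (κ₂ ≫ f₂.den)) ≫ (toBirat F hF hsq).map (κ₂ ≫ f₂.num) =
      inv ((toBirat F hF hsq).map (κ₁ ≫ f₁.den)) ≫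
        (inv ((toBirat F hF hsq).map ρ₂) ≫ (toBirat F hF hsq).map ε₂) ≫
          (toBirat F hF hsq).map (κ₁ ≫ f₁.den)
    rw [IsIso.inv_comp_eq, ← Category.assoc, ← Category.assoc, hden, IsIso.hom_inv_id,
      Category.id_comp, Category.assoc, IsIso.eq_inv_comp, ← Functor.map_comp, ← Functor.map_comp, h₂]
  -- (8) conclude
  rw [hn, eφ, eα]
  change (dI.conj (Mh (End.of ε₂) * ↑v'⁻¹)) ^ (degFr F f₁.num : ℕ) *
      dI.conj (Mh (End.of ε₁) * ↑u⁻¹) =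
    dI.conj (Mh (End.of ε₁) * ↑u⁻¹) * dI.conj (Mh (End.of ε₂) * ↑v'⁻¹)
  rw [← map_pow, ← map_mul, ← map_mul, core]

end Birat

end PreFrobenioid

end Literature.AlgebraicGeometry.Frobenioids
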